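import Summits.QuantumFields.YangMills.Theorems.BalabanLadderIROddTorusTypSmallAction
import Literature.MathematicalPhysics.QuantumFieldTheory.LatticeGaugeShenZhuZhuProofs
import HarnessLib

/-!
# `IR` — the HEREDITARY UPGRADE: single-cell sup-`ζ` rarity ⇒ hereditary joint rarity (pure DLR)

Spine route `BalabanLadder` (route-QuantumFields-BalabanLadder), crux `IR` (stmt-QuantumFields-19354), registered line
«af-pincer-T» (skeleton 0308f95ca6f6a115), clause **(ii_T)** of `AfPincerT.TypShellCond` (hereditary joint rarity of
atypical cells under the kernels `γ_{F'}` of the lattice Yang–Mills specification); owner READING R37 (d)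
(`pub/ym-beyond/p2-g26-files/READINGS-R36-R42-g26.md`): «`HereditaryUpgrade` MAY LAND as a count-neutral helper».
Count-neutral helper (`--supports stmt-QuantumFields-19354 --as helper`); no stub is claimed, no skeleton touched.

## Statement

**Abstract tower lemma (`kernel_allAtypical_le_pow`).**  Let `γ` be a specification (Georgii: probability kernels,
exterior measurability, properness, consistency) on `V → S`, `cells : C → Finset V` a family of PAIRWISE DISJOINT
finite volumes, and `Typ c ⊆ (V → S)` measurable events with `1_{Typ c}` depending only on the spins in `cells c`.
If ONE resampled cell is atypical with probability at most `δ` under EVERY exterior,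
`γ_{cells c}(ζ)((Typ c)ᶜ) ≤ δ` for all `c, ζ`, then for all finite `F ⊆ F'` and every `ζ`
`γ_{⋃_{c ∈ F'} cells c}(ζ){σ | ∀ c ∈ F, σ ∉ Typ c} ≤ δ ^ #F`.

**Proof (tower property).**  Induct on `F`.  For `F = insert c₀ F₀`: consistency `γ_{F'} = γ_{F'} γ_{c₀}`
(`cells c₀ ⊆ ⋃_{F'} cells`); under the inner kernel `γ_{c₀}(σ)` the configuration equals `σ` off `cells c₀`
(properness), and the event «all of `F₀` atypical» reads only cells disjoint from `cells c₀`, so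
`γ_{c₀}(σ)(all of F atypical) = 1[σ: all of F₀ atypical] · γ_{c₀}(σ)((Typ c₀)ᶜ) ≤ 1[…] · δ`; integrate and use the
induction hypothesis.  No reflection positivity, no independence, no chessboard (Georgii 2011, Def. 1.23 and
(1.21); Friedli–Velenik 2017, Lemma 6.13: «pull exterior-measurable factors out of the kernel»).

**Lattice Yang–Mills corollary (`supJointRarity_of_supCellRarity`, `collarJointRarity_of_supCellRarity`).**  For the
kernels `ymSpecification ρ β` of a continuous representation of a compact Hausdorff second-countable group, a grid
`w` with MONOTONE grid lines (in particular every mesh-`b` frame `w i j + b ≤ w i (j+1) ≤ w i j + 2b`,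
`OddTorusChessboard.grid_monotone`) and a
cell-local measurable `Typ`: single-cell sup-`ζ` rarity `γ_{regionEdges w {c}}(ζ)((Typ c)ᶜ) ≤ ofReal δ` (`0 ≤ δ`)
gives `γ_{regionEdges w F'}(ζ){∀ c ∈ F, σ ∉ Typ c} ≤ ofReal (δ ^ #F)` for all `F ⊆ F'` and EVERY `ζ` — in particular
clause (ii_T) of `TypShellCond` verbatim (whose exterior-typicality premiss is simply not used).

**Remark (why monotone grid lines).**  The desk predicate `CertIdeate2g5.HereditaryUpgrade` (certideate-2 g5 Sketch)
quantifies over ALL `w : Fin 4 → ℤ → ℤ`; for a non-monotone `w` two distinct cell indices can have the SAME edge box,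
`Typ c₁ = Typ c₂`, and `δ²` is then false for `F = {c₁, c₂}` — the implication needs the cells to be disjoint, which is
exactly what a frame (`IsFrame b w`, the binder of `TypShellCond`) guarantees.  We therefore state the monotone /
mesh-`b` versions, which are the ones the T line consumes.

Everything here is proved (no `sorry`, no new axioms).  HONEST FRAMING: soft DLR bookkeeping; it makes (ii_T) FREE
given single-cell sup-`ζ` rarity of a candidate `Typ` — the rarity itself, the mixing clause (i_T) and the bridge
`TypCriterion` carry the weight of the line; the conditional chain (Track A) is untouched; not a gap, not Clay.
Refs: Georgii 2011 Def. 1.23, (1.21), Rem. 1.20; Friedli–Velenik 2017 Lemma 6.13–6.15; Seiler LNP 159 Ch. 2.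
-/

set_option autoImplicit false

noncomputable section

open MeasureTheory
open scoped ENNReal
open Literature.Probability.LatticeModels
open Literature.MathematicalPhysics.QuantumLattice
open Literature.MathematicalPhysics.QuantumFieldTheory (isSpecification_ymSpecification_of_t2Space)
open Summit.QuantumFields.YangMills.Cruxes.IR.Tempered (cellEdges regionEdges)

namespace Summit.QuantumFields.YangMills.Theorems.IRRarityUpgrade

/-! ## §1 Properness in event form and the abstract tower lemma -/

section Abstract

variable {V S C : Type*} [MeasurableSpace S]

/-- **Properness, event form.**  If membership in `B` is decided by the spins OFF `Λ`, then under the kernel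
`γ_Λ(· | σ)` the event `A ∩ B` has the mass of `A` when `σ ∈ B` and mass `0` otherwise
(Georgii 2011, Rem. 1.20: `γ_Λ(A ∩ B | σ) = 1_B(σ) γ_Λ(A | σ)` for `B ∈ 𝓕_{Λᶜ}`). -/
theorem kernel_apply_inter_of_dependsOn_compl {γ : Specification V S} (hγ : IsSpecification γ)
    (Λ : Finset V) (σ : V → S) (A : Set (V → S)) {B : Set (V → S)}
    (hB : DependsOn (fun τ : V → S => τ ∈ B) ((↑Λ : Set V)ᶜ)) :
    γ Λ σ (A ∩ B) = B.indicator (fun _ => γ Λ σ A) σ := by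
  have hae : (A ∩ B : Set (V → S)) =ᵐ[γ Λ σ] (A ∩ {_τ | σ ∈ B} : Set (V → S)) := by
    filter_upwards [hγ.proper Λ σ] with τ hτ
    have hτB : (τ ∈ B) = (σ ∈ B) := hB fun i hi => hτ i fun h => hi (Finset.mem_coe.2 h)
    show (τ ∈ A ∩ B) = (τ ∈ A ∩ {_τ | σ ∈ B})
    simp only [Set.mem_inter_iff, Set.mem_setOf_eq, hτB]
  rw [measure_congr hae]
  by_cases hσ : σ ∈ B
  · rw [Set.indicator_of_mem hσ]
    congr 1
    ext τ
    simp [hσ]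
  · rw [Set.indicator_of_notMem hσ]
    have : (A ∩ {_τ | σ ∈ B} : Set (V → S)) = ∅ := by
      ext τ
      simp [hσ]
    rw [this, measure_empty]

omit [MeasurableSpace S] in
/-- The all-atypical event of a finite cell set is a finite intersection of complements. -/
theorem setOf_forall_notMem_eq_iInter (Typ : C → Set (V → S)) (F : Finset C) :
    {σ : V → S | ∀ c ∈ F, σ ∉ Typ c} = ⋂ c ∈ F, (Typ c)ᶜ := by
  ext σ
  simp

/-- The all-atypical event of a finite cell set is measurable. -/
theorem measurableSet_allAtypical {Typ : C → Set (V → S)} (hTm : ∀ c, MeasurableSet (Typ c))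
    (F : Finset C) : MeasurableSet {σ : V → S | ∀ c ∈ F, σ ∉ Typ c} := by
  rw [setOf_forall_notMem_eq_iInter]
  exact Finset.measurableSet_biInter F fun c _ => (hTm c).compl

omit [MeasurableSpace S] in
/-- Cell-locality: the all-atypical event of `F` is decided by the spins off any cell NOT in `F`, provided the cells
are pairwise disjoint. -/
theorem dependsOn_allAtypical_compl (cells : C → Finset V)
    (hdisj : ∀ c c', c ≠ c' → Disjoint (cells c) (cells c')) {Typ : C → Set (V → S)}
    (hTd : ∀ c, DependsOn (fun σ : V → S => σ ∈ Typ c) (↑(cells c) : Set V))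
    {F : Finset C} {c₀ : C} (hc₀ : c₀ ∉ F) :
    DependsOn (fun σ : V → S => σ ∈ {σ : V → S | ∀ c ∈ F, σ ∉ Typ c}) ((↑(cells c₀) : Set V)ᶜ) := by
  intro σ τ hστ
  have hc : ∀ c ∈ F, (σ ∈ Typ c) = (τ ∈ Typ c) := fun c hc => by
    refine hTd c fun i hi => hστ i fun hi₀ => ?_
    have hne : c ≠ c₀ := fun h => hc₀ (h ▸ hc)
    exact Finset.disjoint_left.1 (hdisj c c₀ hne) (Finset.mem_coe.1 hi) (Finset.mem_coe.1 hi₀)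
  simp only [Set.mem_setOf_eq]
  exact propext (forall₂_congr fun c hcF => by rw [hc c hcF])

/-- **The tower lemma (hereditary upgrade, abstract).**  For a specification `γ`, pairwise disjoint cells and
cell-local measurable typical events: if one resampled cell is atypical with probability `≤ δ` under every exterior,
then under the kernel of any finite union of cells `F' ⊇ F`, all cells of `F` are atypical with probability
`≤ δ ^ #F`, for every exterior (Georgii 2011 Def. 1.23: consistency (1.21) + properness Rem. 1.20; induction on `F`). -/
theorem kernel_allAtypical_le_pow [DecidableEq V] {γ : Specification V S} (hγ : IsSpecification γ)
    (cells : C → Finset V) (hdisj : ∀ c c', c ≠ c' → Disjoint (cells c) (cells c'))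
    {Typ : C → Set (V → S)} (hTm : ∀ c, MeasurableSet (Typ c))
    (hTd : ∀ c, DependsOn (fun σ : V → S => σ ∈ Typ c) (↑(cells c) : Set V)) {δ : ℝ≥0∞}
    (h1 : ∀ (c : C) (ζ : V → S), γ (cells c) ζ (Typ c)ᶜ ≤ δ)
    (F F' : Finset C) (hFF' : F ⊆ F') (ζ : V → S) :
    γ (F'.biUnion cells) ζ {σ : V → S | ∀ c ∈ F, σ ∉ Typ c} ≤ δ ^ F.card := by
  classical
  induction F using Finset.induction_on with
  | empty =>
    haveI := hγ.isProbability (F'.biUnion cells) ζ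
    simp
  | @insert c₀ F₀ hc₀ ih =>
    have hc₀F' : c₀ ∈ F' := hFF' (Finset.mem_insert_self c₀ F₀)
    have hF₀F' : F₀ ⊆ F' := (Finset.subset_insert c₀ F₀).trans hFF'
    have hsub : cells c₀ ⊆ F'.biUnion cells := Finset.subset_biUnion_of_mem cells hc₀F'
    set E₀ : Set (V → S) := {σ : V → S | ∀ c ∈ F₀, σ ∉ Typ c} with hE₀
    have hE₀m : MeasurableSet E₀ := measurableSet_allAtypical hTm F₀
    have hEeq : {σ : V → S | ∀ c ∈ insert c₀ F₀, σ ∉ Typ c} = (Typ c₀)ᶜ ∩ E₀ := by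
      ext σ
      simp only [Finset.forall_mem_insert, Set.mem_setOf_eq, Set.mem_inter_iff, Set.mem_compl_iff, hE₀]
    have hEm : MeasurableSet ((Typ c₀)ᶜ ∩ E₀) := (hTm c₀).compl.inter hE₀m
    have hdep : DependsOn (fun σ : V → S => σ ∈ E₀) ((↑(cells c₀) : Set V)ᶜ) :=
      dependsOn_allAtypical_compl cells hdisj hTd hc₀
    -- pointwise bound on the inner kernel
    have hpt : ∀ σ : V → S, γ (cells c₀) σ ((Typ c₀)ᶜ ∩ E₀) ≤ E₀.indicator (fun _ => δ) σ := fun σ => by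
      rw [kernel_apply_inter_of_dependsOn_compl hγ (cells c₀) σ (Typ c₀)ᶜ hdep]
      by_cases hσ : σ ∈ E₀
      · rw [Set.indicator_of_mem hσ, Set.indicator_of_mem hσ]
        exact h1 c₀ σ
      · rw [Set.indicator_of_notMem hσ, Set.indicator_of_notMem hσ]
    rw [hEeq, ← hγ.consistent hsub ζ _ hEm, Finset.card_insert_of_notMem hc₀, pow_succ']
    calc ∫⁻ σ, γ (cells c₀) σ ((Typ c₀)ᶜ ∩ E₀) ∂(γ (F'.biUnion cells) ζ)
        ≤ ∫⁻ σ, E₀.indicator (fun _ => δ) σ ∂(γ (F'.biUnion cells) ζ) := lintegral_mono fun σ => hpt σ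
      _ = δ * γ (F'.biUnion cells) ζ E₀ := lintegral_indicator_const hE₀m δ
      _ ≤ δ * δ ^ F₀.card := by gcongr; exact ih hF₀F'

end Abstract

/-! ## §2 Grid cells: monotone grid lines give pairwise disjoint cells -/

section Grid

/-- Distinct cells of a grid with monotone grid lines have disjoint edge boxes. -/
theorem disjoint_cellEdges {w : Fin 4 → ℤ → ℤ} (hw : ∀ i, Monotone (w i)) {c c' : Fin 4 → ℤ}
    (hcc : c ≠ c') : Disjoint (cellEdges w c) (cellEdges w c') := by
  obtain ⟨i, hi⟩ : ∃ i, c i ≠ c' i := by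
    by_contra h
    push Not at h
    exact hcc (funext h)
  rw [Finset.disjoint_left]
  intro e he he'
  simp only [Summit.QuantumFields.YangMills.Cruxes.IR.Tempered.cellEdges, Finset.mem_product,
    Fintype.mem_piFinset, Finset.mem_Ico, Finset.mem_univ, and_true] at he he'
  rcases lt_or_gt_of_ne hi with hlt | hlt
  · have h1 : w i (c i + 1) ≤ w i (c' i) := hw i (by omega)
    have := (he i).2; have := (he' i).1; omega
  · have h1 : w i (c' i + 1) ≤ w i (c i) := hw i (by omega)
    have := (he i).1; have := (he' i).2; omega

/-- The region of a singleton cell set is the cell. -/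
theorem regionEdges_singleton (w : Fin 4 → ℤ → ℤ) (c : Fin 4 → ℤ) : regionEdges w {c} = cellEdges w c := by
  simp [Summit.QuantumFields.YangMills.Cruxes.IR.Tempered.regionEdges]

end Grid

/-! ## §3 The lattice Yang–Mills corollaries: sup-`ζ` joint rarity and clause (ii_T) -/

section YangMills

variable {G : Type} [Group G] [TopologicalSpace G] [IsTopologicalGroup G] [CompactSpace G]
  [MeasurableSpace G] [BorelSpace G] [T2Space G] [SecondCountableTopology G]
  {N : ℕ} (ρ : G →* Matrix (Fin N) (Fin N) ℂ)

/-- **Hereditary upgrade for the lattice Yang–Mills kernels (monotone grid).**  Single-cell sup-`ζ` rarity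
`γ_{regionEdges w {c}}(ζ)((Typ c)ᶜ) ≤ ofReal δ` for every cell `c` and exterior `ζ` implies, for all finite `F ⊆ F'`
and EVERY exterior `ζ`, `γ_{regionEdges w F'}(ζ){∀ c ∈ F, σ ∉ Typ c} ≤ ofReal (δ ^ #F)` — the sup-`ζ` form of clause
(ii_T) (certideate-2's `SupJointRarity`), with the same `δ`. -/
theorem supJointRarity_of_supCellRarity (hρ : Continuous ρ) (β : ℝ) {w : Fin 4 → ℤ → ℤ}
    (hw : ∀ i, Monotone (w i)) {Typ : (Fin 4 → ℤ) → Set (LGConfig 4 G)} (hTm : ∀ c, MeasurableSet (Typ c))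
    (hTd : ∀ c, DependsOn (fun σ : LGConfig 4 G => σ ∈ Typ c) ↑(cellEdges w c)) {δ : ℝ} (hδ : 0 ≤ δ)
    (h1 : ∀ (c : Fin 4 → ℤ) (ζ : LGConfig 4 G),
      (ymSpecification ρ β (regionEdges w {c}) ζ) (Typ c)ᶜ ≤ ENNReal.ofReal δ)
    (F F' : Finset (Fin 4 → ℤ)) (hFF' : F ⊆ F') (ζ : LGConfig 4 G) :
    (ymSpecification ρ β (regionEdges w F') ζ) {σ : LGConfig 4 G | ∀ c ∈ F, σ ∉ Typ c} ≤
      ENNReal.ofReal (δ ^ F.card) := by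
  classical
  have hγ : IsSpecification (ymSpecification (d := 4) ρ β) := isSpecification_ymSpecification_of_t2Space ρ hρ β
  have h1' : ∀ (c : Fin 4 → ℤ) (ζ : LGConfig 4 G),
      (ymSpecification ρ β (cellEdges w c) ζ) (Typ c)ᶜ ≤ ENNReal.ofReal δ := fun c ζ => by
    rw [← regionEdges_singleton w c]
    exact h1 c ζ
  rw [ENNReal.ofReal_pow hδ]
  exact kernel_allAtypical_le_pow hγ (cellEdges w) (fun c c' h => disjoint_cellEdges hw h) hTm hTd h1' F F'
    hFF' ζ

/-- **Clause (ii_T) of `TypShellCond` from single-cell sup-`ζ` rarity (mesh-`b` frame).**  Verbatim the (ii_T)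
conjunct of `AfPincerT.TypShellCond` for the given `Typ` and `δ`: for finite `F ⊆ F'`, `F ≠ ∅`, and every exterior
typical on the cells adjacent to `F'` (a premiss not needed here), the kernel of `regionEdges w F'` makes all cells of
`F` atypical with probability `≤ ofReal (δ ^ #F)`. -/
theorem collarJointRarity_of_supCellRarity (hρ : Continuous ρ) (β : ℝ) {b : ℕ} {w : Fin 4 → ℤ → ℤ}
    (hw : ∀ i j, w i j + ((b : ℕ) : ℤ) ≤ w i (j + 1) ∧ w i (j + 1) ≤ w i j + 2 * ((b : ℕ) : ℤ))
    {Typ : (Fin 4 → ℤ) → Set (LGConfig 4 G)} (hTm : ∀ c, MeasurableSet (Typ c))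
    (hTd : ∀ c, DependsOn (fun σ : LGConfig 4 G => σ ∈ Typ c) ↑(cellEdges w c)) {δ : ℝ} (hδ : 0 ≤ δ)
    (h1 : ∀ (c : Fin 4 → ℤ) (ζ : LGConfig 4 G),
      (ymSpecification ρ β (regionEdges w {c}) ζ) (Typ c)ᶜ ≤ ENNReal.ofReal δ) :
    ∀ F F' : Finset (Fin 4 → ℤ), F ⊆ F' → F.Nonempty → ∀ ζ : LGConfig 4 G,
      (∀ c' : Fin 4 → ℤ, c' ∉ F' → (∃ c ∈ F', ∀ i, |c' i - c i| ≤ 1) → ζ ∈ Typ c') →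
        (ymSpecification ρ β (regionEdges w F') ζ) {σ : LGConfig 4 G | ∀ c ∈ F, σ ∉ Typ c} ≤
          ENNReal.ofReal (δ ^ F.card) :=
  fun F F' hFF' _ ζ _ =>
    supJointRarity_of_supCellRarity ρ hρ β (OddTorusChessboard.grid_monotone hw) hTm hTd hδ h1 F F' hFF' ζ

end YangMills

end Summit.QuantumFields.YangMills.Theorems.IRRarityUpgrade

end
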